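import Mathlib.Analysis.InnerProductSpace.PiL2
import Mathlib.Tactic.Linarith
import Mathlib.Tactic.LinearCombination
import HarnessLib

/-!
# Link lemma for the birth line — part 1/2: the planar core
# (route `HullExactificationCascade`, crux `ZeroDefectDensity`, stmt-AtomisticToContinuum-12086; line `birth`,
# stub `stub_linkLemma`)

The link lemma (`stub_linkLemma`, part 2) concerns an apex `p`, a shell vertex `c` and the four
common soft contacts `n₁, …, n₄` of `p` and `c`.  Seen from `c` and projected to the plane
orthogonal to `p - c`, the four directions become unit vectors `eᵢ = (xᵢ, yᵢ)` of the plane with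
`0 ≤ ⟪eᵢ, eⱼ⟫ ≤ 0.344` for a soft contact `nᵢ nⱼ` (azimuth gap `≈ 70.5°`) and `⟪eᵢ, eⱼ⟫ ≤ -0.136`
for a non-contact (gap `≥ 97.8°`).  This file is the trigonometry-free planar bookkeeping:

* `link_partnerSide` — scalar core: a unit vector `(l, m)` with `l ≤ 0` that is `0.136`-far from
  a direction `(C, S)` above the axis and from a direction `(C', -S')` below it
  (`0 ≤ C, C' ≤ 0.344`, `S, S' ≥ 0.9389`) has `l ≤ -0.975` (it is within `12.9°` of `(-1, 0)`);
* `link_coreA` — four unit vectors, contacts `12`, `34` with the same orientation, `3` far from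
  `2`, `4` far from `1`: then `⟪e₁, e₃⟫ ≤ -0.975` (relative rotations `eⱼ ēᵢ` as complex products,
  written out in coordinates, reduce it to `link_partnerSide`);
* `link_planarA` — type A links (contacts `12`, `34`; the other four pairs far): either both
  diagonals `13`, `24` or both `23`, `41` are near-antipodal (`≤ -0.975`), by four instances of
  `link_coreA` according to the relative orientation of the two contact pairs;
* `link_planarB` — type B links (contacts `12`, `23`; the other four pairs far):
  `⟪e₁, e₃⟫ ≤ -0.763` (gap `≈ 141°`) and `⟪e₂, e₄⟫ ≤ -0.975`;
* `link_planar` — the registered one-line conjunction of the two (sub-goal of `stub_linkLemma`).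

Mathlib only; no named fact is used.
-/

namespace Summit.AtomisticToContinuum.Crystallization.Theorems.ZeroDefectDensityBirth

/-- **Partner-side core.**  A unit vector `(l, m)` of the plane with `l ≤ 0`, at inner product
`≤ -0.136` from `(C, S)` and from `(C', -S')`, where `0 ≤ C, C' ≤ 0.344` and `S, S' ≥ 0.9389`,
satisfies `l ≤ -0.975`: the two constraints squeeze `|m| ≤ 0.2216`. [folklore] -/
theorem link_partnerSide {C S C' S' l m : ℝ} (hC0 : 0 ≤ C) (hC : C ≤ 0.344) (hS : 0.9389 ≤ S)
    (hC0' : 0 ≤ C') (hC' : C' ≤ 0.344) (hS' : 0.9389 ≤ S') (hlm : l ^ 2 + m ^ 2 = 1)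
    (hl : l ≤ 0) (h1 : l * C + m * S ≤ -0.136) (h2 : l * C' - m * S' ≤ -0.136) :
    l ≤ -0.975 := by
  have hl1 : -1 ≤ l := by nlinarith [sq_nonneg m, sq_nonneg (l + 1)]
  have hm1 : m ≤ 0.2216 := by
    by_contra h
    have hm0 : 0 ≤ m := by linarith [not_le.mp h]
    nlinarith [not_le.mp h, mul_le_mul_of_nonneg_left hS hm0,
      mul_nonneg hC0 (by linarith : 0 ≤ 1 + l)]
  have hm2 : -0.2216 ≤ m := by
    by_contra h
    have hm0 : 0 ≤ -m := by linarith [not_le.mp h]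
    nlinarith [not_le.mp h, mul_le_mul_of_nonneg_left hS' hm0,
      mul_nonneg hC0' (by linarith : 0 ≤ 1 + l)]
  by_contra h
  have h' := not_le.mp h
  nlinarith [mul_pos (by linarith : 0 < l + 0.975) (by linarith : 0 < 0.975 - l),
    mul_self_le_mul_self (abs_nonneg m) (abs_le.mpr ⟨hm2, hm1⟩), sq_abs m]

/-- From `S² ≥ 1 - 0.344²` and `0 < S`: `0.9389 ≤ S`. [folklore] -/
theorem link_sin_lower {C S : ℝ} (h : C ^ 2 + S ^ 2 = 1) (hC0 : 0 ≤ C) (hC : C ≤ 0.344)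
    (hS : 0 < S) : 0.9389 ≤ S := by
  by_contra h'
  nlinarith [not_le.mp h', mul_le_mul hC hC hC0 (by norm_num : (0 : ℝ) ≤ 0.344),
    mul_pos (by linarith [not_le.mp h'] : 0 < 0.9389 - S) (by linarith : 0 < 0.9389 + S)]

/-- **Core of type A.**  Unit vectors `e₁, …, e₄` of the plane, `eᵢ = (xᵢ, yᵢ)`, with contacts
`0 ≤ ⟪e₁, e₂⟫, ⟪e₃, e₄⟫ ≤ 0.344` of the same orientation (`[e₁, e₂] · [e₃, e₄] > 0`),
`⟪e₁, e₃⟫ ≤ 0`, `⟪e₂, e₃⟫ ≤ -0.136` and `⟪e₁, e₄⟫ ≤ -0.136` satisfy `⟪e₁, e₃⟫ ≤ -0.975`.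
In terms of the relative rotations `a = e₂ē₁ = (C, S₀)`, `z = e₃ē₁ = (l, m)`, `e₄ē₃ = (C', S₀')`
(complex products in coordinates) one has `Re (z ā) = ⟪e₂, e₃⟫` and
`Re (z · e₄ē₃) = ⟪e₁, e₄⟫`, so this is `link_partnerSide` up to a reflection. [folklore] -/
theorem link_coreA {x₁ y₁ x₂ y₂ x₃ y₃ x₄ y₄ : ℝ} (h₁ : x₁ ^ 2 + y₁ ^ 2 = 1)
    (h₂ : x₂ ^ 2 + y₂ ^ 2 = 1) (h₃ : x₃ ^ 2 + y₃ ^ 2 = 1) (h₄ : x₄ ^ 2 + y₄ ^ 2 = 1)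
    (c₁₂ : 0 ≤ x₁ * x₂ + y₁ * y₂) (c₁₂' : x₁ * x₂ + y₁ * y₂ ≤ 0.344)
    (c₃₄ : 0 ≤ x₃ * x₄ + y₃ * y₄) (c₃₄' : x₃ * x₄ + y₃ * y₄ ≤ 0.344)
    (ho : 0 < (x₁ * y₂ - y₁ * x₂) * (x₃ * y₄ - y₃ * x₄))
    (f₁₃ : x₁ * x₃ + y₁ * y₃ ≤ 0) (f₂₃ : x₂ * x₃ + y₂ * y₃ ≤ -0.136)
    (f₁₄ : x₁ * x₄ + y₁ * y₄ ≤ -0.136) : x₁ * x₃ + y₁ * y₃ ≤ -0.975 := by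
  -- relative rotations
  have hCS : (x₁ * x₂ + y₁ * y₂) ^ 2 + (x₁ * y₂ - y₁ * x₂) ^ 2 = 1 := by
    linear_combination (x₂ ^ 2 + y₂ ^ 2) * h₁ + h₂
  have hCS' : (x₃ * x₄ + y₃ * y₄) ^ 2 + (x₃ * y₄ - y₃ * x₄) ^ 2 = 1 := by
    linear_combination (x₄ ^ 2 + y₄ ^ 2) * h₃ + h₄
  have hlm : (x₁ * x₃ + y₁ * y₃) ^ 2 + (x₁ * y₃ - y₁ * x₃) ^ 2 = 1 := by
    linear_combination (x₃ ^ 2 + y₃ ^ 2) * h₁ + h₃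
  have e₂₃ : (x₁ * x₃ + y₁ * y₃) * (x₁ * x₂ + y₁ * y₂) + (x₁ * y₃ - y₁ * x₃) * (x₁ * y₂ - y₁ * x₂)
      = x₂ * x₃ + y₂ * y₃ := by
    linear_combination (x₂ * x₃ + y₂ * y₃) * h₁
  have e₁₄ : (x₁ * x₃ + y₁ * y₃) * (x₃ * x₄ + y₃ * y₄) - (x₁ * y₃ - y₁ * x₃) * (x₃ * y₄ - y₃ * x₄)
      = x₁ * x₄ + y₁ * y₄ := by
    linear_combination (x₁ * x₄ + y₁ * y₄) * h₃
  rcases lt_trichotomy 0 (x₁ * y₂ - y₁ * x₂) with hS | hS | hS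
  · have hS' : 0 < x₃ * y₄ - y₃ * x₄ := pos_of_mul_pos_right ho hS.le
    exact link_partnerSide c₁₂ c₁₂' (link_sin_lower hCS c₁₂ c₁₂' hS) c₃₄ c₃₄'
      (link_sin_lower hCS' c₃₄ c₃₄' hS') hlm f₁₃ (by linarith [e₂₃]) (by linarith [e₁₄])
  · rw [← hS, zero_mul] at ho
    exact absurd ho (lt_irrefl 0)
  · have hS' : x₃ * y₄ - y₃ * x₄ < 0 := neg_of_mul_pos_right ho hS.le
    have hCSn : (x₁ * x₂ + y₁ * y₂) ^ 2 + (-(x₁ * y₂ - y₁ * x₂)) ^ 2 = 1 := by linear_combination hCS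
    have hCSn' : (x₃ * x₄ + y₃ * y₄) ^ 2 + (-(x₃ * y₄ - y₃ * x₄)) ^ 2 = 1 := by linear_combination hCS'
    have hlmn : (x₁ * x₃ + y₁ * y₃) ^ 2 + (-(x₁ * y₃ - y₁ * x₃)) ^ 2 = 1 := by linear_combination hlm
    exact link_partnerSide c₁₂ c₁₂' (link_sin_lower hCSn c₁₂ c₁₂' (by linarith)) c₃₄ c₃₄'
      (link_sin_lower hCSn' c₃₄ c₃₄' (by linarith)) hlmn f₁₃ (by linarith [e₂₃]) (by linarith [e₁₄])

/-- **Planar type A.**  Unit vectors `e₁, …, e₄` of the plane with contacts `12`, `34`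
(`0 ≤ ⟪·,·⟫ ≤ 0.344`) and far pairs `13`, `24`, `23`, `41` (`⟪·,·⟫ ≤ -0.136`): either both diagonals
`13`, `24` or both `23`, `41` have inner product `≤ -0.975` — the former when the two contact pairs
have the same orientation, the latter otherwise (four instances of `link_coreA`). [folklore] -/
theorem link_planarA {x₁ y₁ x₂ y₂ x₃ y₃ x₄ y₄ : ℝ} (h₁ : x₁ ^ 2 + y₁ ^ 2 = 1)
    (h₂ : x₂ ^ 2 + y₂ ^ 2 = 1) (h₃ : x₃ ^ 2 + y₃ ^ 2 = 1) (h₄ : x₄ ^ 2 + y₄ ^ 2 = 1)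
    (c₁₂ : 0 ≤ x₁ * x₂ + y₁ * y₂) (c₁₂' : x₁ * x₂ + y₁ * y₂ ≤ 0.344)
    (c₃₄ : 0 ≤ x₃ * x₄ + y₃ * y₄) (c₃₄' : x₃ * x₄ + y₃ * y₄ ≤ 0.344)
    (f₁₃ : x₁ * x₃ + y₁ * y₃ ≤ -0.136) (f₂₄ : x₂ * x₄ + y₂ * y₄ ≤ -0.136)
    (f₂₃ : x₂ * x₃ + y₂ * y₃ ≤ -0.136) (f₄₁ : x₄ * x₁ + y₄ * y₁ ≤ -0.136) :
    (x₁ * x₃ + y₁ * y₃ ≤ -0.975 ∧ x₂ * x₄ + y₂ * y₄ ≤ -0.975) ∨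
      (x₂ * x₃ + y₂ * y₃ ≤ -0.975 ∧ x₄ * x₁ + y₄ * y₁ ≤ -0.975) := by
  have hCS : (x₁ * x₂ + y₁ * y₂) ^ 2 + (x₁ * y₂ - y₁ * x₂) ^ 2 = 1 := by
    linear_combination (x₂ ^ 2 + y₂ ^ 2) * h₁ + h₂
  have hCS' : (x₃ * x₄ + y₃ * y₄) ^ 2 + (x₃ * y₄ - y₃ * x₄) ^ 2 = 1 := by
    linear_combination (x₄ ^ 2 + y₄ ^ 2) * h₃ + h₄
  have hS0 : x₁ * y₂ - y₁ * x₂ ≠ 0 := fun h => by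
    rw [h] at hCS
    nlinarith [mul_le_mul c₁₂' c₁₂' c₁₂ (by norm_num : (0 : ℝ) ≤ 0.344)]
  have hS0' : x₃ * y₄ - y₃ * x₄ ≠ 0 := fun h => by
    rw [h] at hCS'
    nlinarith [mul_le_mul c₃₄' c₃₄' c₃₄ (by norm_num : (0 : ℝ) ≤ 0.344)]
  rcases lt_or_gt_of_ne (mul_ne_zero hS0 hS0') with ho | ho
  · right
    constructor
    · -- core on (2, 1, 3, 4)
      refine link_coreA h₂ h₁ h₃ h₄ (by linarith) (by linarith) c₃₄ c₃₄' (by nlinarith [ho])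
        (by linarith) (by linarith) f₂₄
    · -- core on (1, 2, 4, 3)
      have := link_coreA h₁ h₂ h₄ h₃ c₁₂ c₁₂' (by linarith) (by linarith) (by nlinarith [ho])
        (by linarith) (by linarith) f₁₃
      linarith
  · left
    constructor
    · exact link_coreA h₁ h₂ h₃ h₄ c₁₂ c₁₂' c₃₄ c₃₄' ho (by linarith) f₂₃ (by linarith)
    · -- core on (2, 1, 4, 3)
      exact link_coreA h₂ h₁ h₄ h₃ (by linarith) (by linarith) (by linarith) (by linarith)
        (by nlinarith [ho]) (by linarith) (by linarith) f₂₃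

/-- **Planar type B.**  Unit vectors `e₁, …, e₄` of the plane with contacts `12`, `23`
(`0 ≤ ⟪·,·⟫ ≤ 0.344`) and far pairs `13`, `24`, `34`, `41` (`⟪·,·⟫ ≤ -0.136`): then
`⟪e₁, e₃⟫ ≤ -0.763` (the contacts `e₁`, `e₃` of `e₂` lie on opposite sides of `e₂`, since on the
same side they would be close) and `⟪e₂, e₄⟫ ≤ -0.975` (`link_partnerSide` about `e₂`). [folklore] -/
theorem link_planarB {x₁ y₁ x₂ y₂ x₃ y₃ x₄ y₄ : ℝ} (h₁ : x₁ ^ 2 + y₁ ^ 2 = 1)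
    (h₂ : x₂ ^ 2 + y₂ ^ 2 = 1) (h₃ : x₃ ^ 2 + y₃ ^ 2 = 1) (h₄ : x₄ ^ 2 + y₄ ^ 2 = 1)
    (c₁₂ : 0 ≤ x₁ * x₂ + y₁ * y₂) (c₁₂' : x₁ * x₂ + y₁ * y₂ ≤ 0.344)
    (c₂₃ : 0 ≤ x₂ * x₃ + y₂ * y₃) (c₂₃' : x₂ * x₃ + y₂ * y₃ ≤ 0.344)
    (f₁₃ : x₁ * x₃ + y₁ * y₃ ≤ -0.136) (f₂₄ : x₂ * x₄ + y₂ * y₄ ≤ -0.136)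
    (f₃₄ : x₃ * x₄ + y₃ * y₄ ≤ -0.136) (f₄₁ : x₄ * x₁ + y₄ * y₁ ≤ -0.136) :
    x₁ * x₃ + y₁ * y₃ ≤ -0.763 ∧ x₂ * x₄ + y₂ * y₄ ≤ -0.975 := by
  -- relative rotations about `e₂`: `a = e₁ē₂ = (C, S₀)`, `b = e₃ē₂ = (C', T₀)`, `z = e₄ē₂ = (l, m)`
  have hCS : (x₁ * x₂ + y₁ * y₂) ^ 2 + (x₂ * y₁ - y₂ * x₁) ^ 2 = 1 := by
    linear_combination (x₁ ^ 2 + y₁ ^ 2) * h₂ + h₁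
  have hCT : (x₂ * x₃ + y₂ * y₃) ^ 2 + (x₂ * y₃ - y₂ * x₃) ^ 2 = 1 := by
    linear_combination (x₃ ^ 2 + y₃ ^ 2) * h₂ + h₃
  have hlm : (x₂ * x₄ + y₂ * y₄) ^ 2 + (x₂ * y₄ - y₂ * x₄) ^ 2 = 1 := by
    linear_combination (x₄ ^ 2 + y₄ ^ 2) * h₂ + h₄
  have e₁₃ : (x₁ * x₂ + y₁ * y₂) * (x₂ * x₃ + y₂ * y₃) + (x₂ * y₁ - y₂ * x₁) * (x₂ * y₃ - y₂ * x₃)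
      = x₁ * x₃ + y₁ * y₃ := by
    linear_combination (x₁ * x₃ + y₁ * y₃) * h₂
  have e₄₁ : (x₂ * x₄ + y₂ * y₄) * (x₁ * x₂ + y₁ * y₂) + (x₂ * y₄ - y₂ * x₄) * (x₂ * y₁ - y₂ * x₁)
      = x₄ * x₁ + y₄ * y₁ := by
    linear_combination (x₄ * x₁ + y₄ * y₁) * h₂
  have e₃₄ : (x₂ * x₄ + y₂ * y₄) * (x₂ * x₃ + y₂ * y₃) + (x₂ * y₄ - y₂ * x₄) * (x₂ * y₃ - y₂ * x₃)
      = x₃ * x₄ + y₃ * y₄ := by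
    linear_combination (x₃ * x₄ + y₃ * y₄) * h₂
  -- the two contacts of `e₂` lie on opposite sides
  have hopp : (x₂ * y₁ - y₂ * x₁) * (x₂ * y₃ - y₂ * x₃) < 0 := by
    nlinarith [mul_nonneg c₁₂ c₂₃]
  rcases lt_or_gt_of_ne (show x₂ * y₁ - y₂ * x₁ ≠ 0 from fun h => by
    rw [h, zero_mul] at hopp; exact lt_irrefl 0 hopp) with hS | hS
  · -- `e₁` below, `e₃` above
    have hT : 0 < x₂ * y₃ - y₂ * x₃ := pos_of_mul_neg_right hopp hS.le
    have hSb := link_sin_lower (by linear_combination hCS :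
      (x₁ * x₂ + y₁ * y₂) ^ 2 + (-(x₂ * y₁ - y₂ * x₁)) ^ 2 = 1) c₁₂ c₁₂' (by linarith)
    have hTb := link_sin_lower hCT c₂₃ c₂₃' hT
    constructor
    · nlinarith [mul_le_mul hSb hTb (by norm_num) (by linarith),
        mul_le_mul c₁₂' c₂₃' c₂₃ (by norm_num : (0 : ℝ) ≤ 0.344)]
    · exact link_partnerSide c₂₃ c₂₃' hTb c₁₂ c₁₂' hSb hlm (by linarith) (by linarith [e₃₄])
        (by linarith [e₄₁])
  · -- `e₁` above, `e₃` below
    have hT : x₂ * y₃ - y₂ * x₃ < 0 := neg_of_mul_neg_right hopp hS.le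
    have hSb := link_sin_lower hCS c₁₂ c₁₂' hS
    have hTb := link_sin_lower (by linear_combination hCT :
      (x₂ * x₃ + y₂ * y₃) ^ 2 + (-(x₂ * y₃ - y₂ * x₃)) ^ 2 = 1) c₂₃ c₂₃' (by linarith)
    constructor
    · nlinarith [mul_le_mul hSb hTb (by norm_num) (by linarith),
        mul_le_mul c₁₂' c₂₃' c₂₃ (by norm_num : (0 : ℝ) ≤ 0.344)]
    · exact link_partnerSide c₁₂ c₁₂' hSb c₂₃ c₂₃' hTb hlm (by linarith) (by linarith [e₄₁])
        (by linarith [e₃₄])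

/-- **Planar link lemma** (registered sub-goal `link_planar` of `stub_linkLemma`, one line): the
conjunction of `link_planarA` and `link_planarB` with explicit binders. [folklore] -/
theorem link_planar : (∀ (x₁ y₁ x₂ y₂ x₃ y₃ x₄ y₄ : ℝ), x₁ ^ 2 + y₁ ^ 2 = 1 → x₂ ^ 2 + y₂ ^ 2 = 1 → x₃ ^ 2 + y₃ ^ 2 = 1 → x₄ ^ 2 + y₄ ^ 2 = 1 → 0 ≤ x₁ * x₂ + y₁ * y₂ → x₁ * x₂ + y₁ * y₂ ≤ 0.344 → 0 ≤ x₃ * x₄ + y₃ * y₄ → x₃ * x₄ + y₃ * y₄ ≤ 0.344 → x₁ * x₃ + y₁ * y₃ ≤ -0.136 → x₂ * x₄ + y₂ * y₄ ≤ -0.136 → x₂ * x₃ + y₂ * y₃ ≤ -0.136 → x₄ * x₁ + y₄ * y₁ ≤ -0.136 → (x₁ * x₃ + y₁ * y₃ ≤ -0.975 ∧ x₂ * x₄ + y₂ * y₄ ≤ -0.975) ∨ (x₂ * x₃ + y₂ * y₃ ≤ -0.975 ∧ x₄ * x₁ + y₄ * y₁ ≤ -0.975)) ∧ (∀ (x₁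 y₁ x₂ y₂ x₃ y₃ x₄ y₄ : ℝ), x₁ ^ 2 + y₁ ^ 2 = 1 → x₂ ^ 2 + y₂ ^ 2 = 1 → x₃ ^ 2 + y₃ ^ 2 = 1 → x₄ ^ 2 + y₄ ^ 2 = 1 → 0 ≤ x₁ * x₂ + y₁ * y₂ → x₁ * x₂ + y₁ * y₂ ≤ 0.344 → 0 ≤ x₂ * x₃ + y₂ * y₃ → x₂ * x₃ + y₂ * y₃ ≤ 0.344 → x₁ * x₃ + y₁ * y₃ ≤ -0.136 → x₂ * x₄ + y₂ * y₄ ≤ -0.136 → x₃ * x₄ + y₃ * y₄ ≤ -0.136 → x₄ * x₁ + y₄ * y₁ ≤ -0.136 → x₁ * x₃ + y₁ * y₃ ≤ -0.763 ∧ x₂ * x₄ + y₂ * y₄ ≤ -0.975) :=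
  ⟨fun _ _ _ _ _ _ _ _ h₁ h₂ h₃ h₄ c₁₂ c₁₂' c₃₄ c₃₄' f₁₃ f₂₄ f₂₃ f₄₁ =>
      link_planarA h₁ h₂ h₃ h₄ c₁₂ c₁₂' c₃₄ c₃₄' f₁₃ f₂₄ f₂₃ f₄₁,
    fun _ _ _ _ _ _ _ _ h₁ h₂ h₃ h₄ c₁₂ c₁₂' c₂₃ c₂₃' f₁₃ f₂₄ f₃₄ f₄₁ =>
      link_planarB h₁ h₂ h₃ h₄ c₁₂ c₁₂' c₂₃ c₂₃' f₁₃ f₂₄ f₃₄ f₄₁⟩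

end Summit.AtomisticToContinuum.Crystallization.Theorems.ZeroDefectDensityBirth
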